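import Mathlib.Topology.Covering.Quotient
import Mathlib.Topology.Algebra.Group.DiscontinuousSubgroup
import Literature.LinearAlgebra.QuadraticForm.PosComplexStructuresStabilizer
import HarnessLib

/-!
# The arithmetic group acts properly discontinuously on `X⁺`; the quotient `Γ\X⁺`

Topic `LinearAlgebra/QuadraticForm`, sequel of `QuadraticForm/PosComplexStructuresStabilizer`
(finite stabilisers, free action of a torsion-free group) and
`QuadraticForm/PosComplexStructuresConnected` (`X⁺` is path connected). Setting of
[Deligne1982HodgeCycles, proof of Thm. 4.8, pp. 48–50]: a finite-dimensional real space
`V = V(ℝ)`, the action `k` of `√-d`, an alternating form `ψ`, the period domain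
`X⁺ = posComplexStructures k ψ` of `k`-linear `ψ`-positive complex structures, a full lattice
`V(ℤ) = Λ ⊂ V`, and the group `Γ` of automorphisms of `(V(ℤ), ψ)` commuting with `k`, acting on
`X⁺` by `J ↦ g J g⁻¹`; the base of Deligne's algebraic family is the quotient `Γ\X⁺` by a
torsion-free congruence subgroup (p. 50). This file supplies the topological half of "`Γ\X⁺` is a
manifold": the action is PROPERLY DISCONTINUOUS, the quotient is Hausdorff, and for torsion-free `Γ`
the projection `X⁺ → Γ\X⁺` is a covering map. The model is [Lange2023AbelianVarietiesComplex,
Prop. 3.1.8–3.1.9] (any discrete subgroup of `Sp_{2g}(ℝ)` acts properly discontinuously on the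
Siegel space, because the orbit map is proper), here for the unitary period domain and proved by
the same compactness argument as the finiteness of the stabilisers (loc. cit. Cor. 2.4.10): on a
compact set of positive complex structures the positive definite forms `ψ (x, J x)` are UNIFORMLY
comparable to `‖x‖²`, so an isometry `g` of `ψ` carrying some `J ∈ K` to some `J' ∈ K` is
uniformly bounded, and a bounded set of lattice endomorphisms is finite.

* `continuous_bilin_uncurry`, `continuous_apply_apply_self` — joint continuity of `ψ` and of
  `(J, x) ↦ ψ (x, J x)` (finite dimension);
* `exists_uniform_bounds_of_isCompact` — `c ‖x‖² ≤ ψ (x, J x) ≤ C ‖x‖²` uniformly in `J ∈ K`,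
  `K` compact, all `J ∈ K` positive;
* `finite_setOf_norm_le_mapsTo` — a norm-bounded set of endomorphisms mapping the lattice `Λ`
  into itself is finite;
* `finite_setOf_isometry_mapsTo_of_isCompact` — MAIN: for `K` compact consisting of `ψ`-positive
  operators, the set of `ψ`-isometries `g` with `g Λ ⊆ Λ` and `g J = J' g` for some `J, J' ∈ K`
  is finite;
* `isOpen_setOf_pos`, `isClosed_setOf_sq_commute_isometry`, `isLocallyClosed_posComplexStructures`
  — positivity is an open condition, the algebraic conditions are closed, so `X⁺` is locally
  closed in `End V`, hence locally compact;
* `arithmeticGroup k ψ Λ` — the subgroup of `GL(V)` of `ψ`-isometries commuting with `k` and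
  preserving `Λ` (Deligne's `Γ` for level `1`), with its conjugation action on `X⁺`
  (`arithmeticGroup.mulAction`, `arithmeticGroup.continuousConstSMul`), which is properly
  discontinuous (`arithmeticGroup.properlyDiscontinuousSMul`, from the MAIN theorem); hence
  (Mathlib) every subgroup `G` acts properly discontinuously, `G\X⁺` is Hausdorff
  (`arithmeticGroup.t2Space_quotient`), a subgroup without non-trivial elements of finite order
  acts freely (`arithmeticGroup.isCancelSMul_of_torsionFree`, from
  `eq_one_of_commute_of_torsionFree`) and `X⁺ → G\X⁺` is a covering map
  (`arithmeticGroup.isQuotientCoveringMap_of_torsionFree`,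
  `arithmeticGroup.isCoveringMap_quotientMk_of_torsionFree`).

Everything is proved, Mathlib only; the only definitions are the group `arithmeticGroup` and its
action; no named facts. Deliberately NOT here: the complex structure of `X⁺` and of `Γ\X⁺`
(Cartan's theorem, [Lange2023AbelianVarietiesComplex, Thm. 3.1.11]), algebraicity (Baily–Borel).

## References

* [Deligne1982HodgeCycles] P. Deligne (notes by J. S. Milne), Hodge cycles on abelian varieties,
  LNM 900 (1982), proof of Thm. 4.8, pp. 48–50 (the group `Γ`, the quotient `Γ\X⁺`).
* [Lange2023AbelianVarietiesComplex] H. Lange, Abelian Varieties over the Complex Numbers: A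
  Graduate Course, Grundlehren Text Editions, Springer 2023, Ch. 3 §3.1, Prop. 3.1.8, Prop. 3.1.9
  ("Any discrete subgroup `G ⊂ Sp_{2g}(ℝ)` acts properly and discontinuously on `𝔥_g`"),
  Remark 3.1.10, Thm. 3.1.11; Ch. 2 §2.4, Cor. 2.4.10 (held in the literature store under the key
  `book:lange1992-complex-abelian-varieties`, chunks 161–162 and 116–117).
-/

noncomputable section

namespace Literature.LinearAlgebra.QuadraticForm

open Module Set Metric Filter Topology

variable {V : Type*} [NormedAddCommGroup V] [NormedSpace ℝ V]

/-! ### Joint continuity and uniform coercivity -/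

/-- A bilinear form on a finite-dimensional space is jointly continuous. [folklore] -/
theorem continuous_bilin_uncurry [FiniteDimensional ℝ V] (ψ : LinearMap.BilinForm ℝ V) :
    Continuous fun p : V × V => ψ p.1 p.2 := by
  let Ψ : V →L[ℝ] (V →L[ℝ] ℝ) :=
    LinearMap.toContinuousLinearMap
      ((LinearMap.toContinuousLinearMap : (V →ₗ[ℝ] ℝ) ≃ₗ[ℝ] (V →L[ℝ] ℝ)).toLinearMap ∘ₗ ψ)
  exact Ψ.continuous₂

/-- `(J, x) ↦ ψ (x, J x)` is jointly continuous on `End V × V` (finite dimension). [folklore] -/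
theorem continuous_apply_apply_self [FiniteDimensional ℝ V] (ψ : LinearMap.BilinForm ℝ V) :
    Continuous fun p : (V →L[ℝ] V) × V => ψ p.2 (p.1 p.2) :=
  (continuous_bilin_uncurry ψ).comp (continuous_snd.prodMk isBoundedBilinearMap_apply.continuous)

/-- The normalisation `‖x‖⁻¹ • x` of a non-zero vector lies on the unit sphere. [folklore] -/
theorem inv_norm_smul_mem_sphere {x : V} (hx : x ≠ 0) : ‖x‖⁻¹ • x ∈ sphere (0 : V) 1 := by
  rw [mem_sphere_zero_iff_norm, norm_smul, norm_inv, norm_norm,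
    inv_mul_cancel₀ (norm_ne_zero_iff.2 hx)]

omit [NormedSpace ℝ V] in
/-- A point of the unit sphere is non-zero. [folklore] -/
theorem ne_zero_of_mem_unit_sphere {x : V} (hx : x ∈ sphere (0 : V) 1) : x ≠ 0 := by
  intro h
  rw [mem_sphere_zero_iff_norm, h, norm_zero] at hx
  exact zero_ne_one hx

/-- **Uniform coercivity over a compact set of positive operators.** If `K ⊆ End V` is compact
and every `J ∈ K` is `ψ`-positive (`ψ (x, J x) > 0` for `x ≠ 0`), then there are constants
`0 < c`, `0 ≤ C`, independent of `J`, with `c ‖x‖² ≤ ψ (x, J x) ≤ C ‖x‖²` for all `J ∈ K` and all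
`x` (extrema of the jointly continuous `(J, x) ↦ ψ (x, J x)` on the compact `K × sphere`).
[folklore] -/
theorem exists_uniform_bounds_of_isCompact [FiniteDimensional ℝ V] (ψ : LinearMap.BilinForm ℝ V)
    {K : Set (V →L[ℝ] V)} (hK : IsCompact K) (hpos : ∀ J ∈ K, ∀ x, x ≠ 0 → 0 < ψ x (J x)) :
    ∃ c C : ℝ, 0 < c ∧ 0 ≤ C ∧
      ∀ J ∈ K, ∀ x, c * ‖x‖ ^ 2 ≤ ψ x (J x) ∧ ψ x (J x) ≤ C * ‖x‖ ^ 2 := by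
  set F : (V →L[ℝ] V) × V → ℝ := fun p => ψ p.2 (p.1 p.2) with hF
  have hFc : Continuous F := continuous_apply_apply_self ψ
  have hF2 : ∀ (J : V →L[ℝ] V) (t : ℝ) (x : V), F (J, t • x) = t ^ 2 * F (J, x) :=
    fun J t x => by
      simp only [hF, map_smul, LinearMap.smul_apply, smul_eq_mul]
      ring
  have hF0 : ∀ J : V →L[ℝ] V, F (J, 0) = 0 := fun J => by simp [hF]
  rcases (K ×ˢ sphere (0 : V) 1).eq_empty_or_nonempty with he | hne
  · -- `K = ∅` or `V = 0`: only `x = 0` occurs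
    refine ⟨1, 0, one_pos, le_rfl, fun J hJ x => ?_⟩
    have hx : x = 0 := by
      by_contra hx
      exact (Set.eq_empty_iff_forall_notMem.1 he (J, ‖x‖⁻¹ • x)) ⟨hJ, inv_norm_smul_mem_sphere hx⟩
    subst hx
    rw [show ψ 0 (J 0) = F (J, 0) from rfl, hF0, norm_zero, zero_pow two_ne_zero, mul_zero,
      mul_zero]
    exact ⟨le_rfl, le_rfl⟩
  · have hc : IsCompact (K ×ˢ sphere (0 : V) 1) := hK.prod (isCompact_sphere 0 1)
    obtain ⟨p₀, hp₀, hmin⟩ := hc.exists_isMinOn hne hFc.continuousOn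
    obtain ⟨p₁, hp₁, hmax⟩ := hc.exists_isMaxOn hne hFc.continuousOn
    refine ⟨F p₀, max (F p₁) 0, hpos p₀.1 hp₀.1 p₀.2 (ne_zero_of_mem_unit_sphere hp₀.2),
      le_max_right _ _, fun J hJ x => ?_⟩
    change F p₀ * ‖x‖ ^ 2 ≤ F (J, x) ∧ F (J, x) ≤ max (F p₁) 0 * ‖x‖ ^ 2
    rcases eq_or_ne x 0 with rfl | hx
    · rw [hF0, norm_zero, zero_pow two_ne_zero, mul_zero, mul_zero]
      exact ⟨le_rfl, le_rfl⟩
    · have hnx : 0 < ‖x‖ := norm_pos_iff.2 hx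
      have hmem : (J, ‖x‖⁻¹ • x) ∈ K ×ˢ sphere (0 : V) 1 := ⟨hJ, inv_norm_smul_mem_sphere hx⟩
      have h3 : F p₀ ≤ F (J, ‖x‖⁻¹ • x) := isMinOn_iff.1 hmin _ hmem
      have h4 : F (J, ‖x‖⁻¹ • x) ≤ F p₁ := isMaxOn_iff.1 hmax _ hmem
      rw [hF2, inv_pow] at h3 h4
      have h5 : 0 < ‖x‖ ^ 2 := by positivity
      constructor
      · calc F p₀ * ‖x‖ ^ 2 ≤ (‖x‖ ^ 2)⁻¹ * F (J, x) * ‖x‖ ^ 2 :=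
              mul_le_mul_of_nonneg_right h3 h5.le
          _ = F (J, x) := by field_simp
      · calc F (J, x) = (‖x‖ ^ 2)⁻¹ * F (J, x) * ‖x‖ ^ 2 := by field_simp
          _ ≤ F p₁ * ‖x‖ ^ 2 := mul_le_mul_of_nonneg_right h4 h5.le
          _ ≤ max (F p₁) 0 * ‖x‖ ^ 2 := mul_le_mul_of_nonneg_right (le_max_left _ _) h5.le

/-! ### Finiteness -/

/-- **A norm-bounded set of lattice endomorphisms is finite.** For a full `ℤ`-lattice `Λ ⊂ V`
and `R : ℝ`, the set of `g ∈ End V` with `‖g x‖ ≤ R ‖x‖` for all `x` and `g Λ ⊆ Λ` is finite: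
`g` is determined by the images of a `ℤ`-basis `(eᵢ)` of `Λ`, which lie in the finite sets
`Λ ∩ B(0, R ‖eᵢ‖)` (a discrete closed set meets a bounded set in a finite set). [folklore] -/
theorem finite_setOf_norm_le_mapsTo [FiniteDimensional ℝ V] (Λ : Submodule ℤ V)
    [DiscreteTopology Λ] [IsZLattice ℝ Λ] (R : ℝ) :
    {g : V →L[ℝ] V | (∀ x, ‖g x‖ ≤ R * ‖x‖) ∧ ∀ v ∈ Λ, g v ∈ Λ}.Finite := by
  let ι := Module.Free.ChooseBasisIndex ℤ Λ
  let bΛ : Basis ι ℤ Λ := Module.Free.chooseBasis ℤ Λ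
  let B : Basis ι ℝ V := bΛ.ofZLatticeBasis ℝ Λ
  have hBmem : ∀ i, B i ∈ Λ := fun i => by
    rw [Basis.ofZLatticeBasis_apply]
    exact (bΛ i).2
  have hclosed : IsClosed (Λ : Set V) := AddSubgroup.isClosed_of_discrete (H := Λ.toAddSubgroup)
  have hdisc : IsDiscrete (Λ : Set V) := SetLike.isDiscrete_iff_discreteTopology.mpr inferInstance
  have hT : (Set.univ.pi fun i : ι => closedBall (0 : V) (R * ‖B i‖) ∩ (Λ : Set V)).Finite :=
    Set.Finite.pi fun i => finite_isBounded_inter_isClosed hdisc isBounded_closedBall hclosed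
  let F : (V →L[ℝ] V) → (ι → V) := fun g i => g (B i)
  have hF : Function.Injective F := fun g g' h =>
    ContinuousLinearMap.coe_inj.1 (B.ext fun i => congr_fun h i)
  refine (hT.preimage hF.injOn).subset fun g hg => ?_
  simp only [Set.mem_preimage, Set.mem_univ_pi, Set.mem_inter_iff, mem_closedBall, dist_zero_right,
    SetLike.mem_coe]
  exact fun i => ⟨hg.1 (B i), hg.2 _ (hBmem i)⟩

/-- **Proper discontinuity, operator form** (MAIN). Let `K ⊆ End V` be compact, consisting of
`ψ`-positive operators, and `Λ ⊂ V` a full `ℤ`-lattice. Then the set of `g ∈ End V` preserving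
`ψ`, mapping `Λ` into itself and INTERTWINING two members of `K` (`g J = J' g` with
`J, J' ∈ K`; for invertible `g`: `g J g⁻¹ ∈ K` for some `J ∈ K`) is finite. Indeed
`c ‖g x‖² ≤ ψ (g x, J' g x) = ψ (g x, g J x) = ψ (x, J x) ≤ C ‖x‖²` with the uniform constants of
`exists_uniform_bounds_of_isCompact`, so `‖g‖ ≤ √(C/c)`, and `finite_setOf_norm_le_mapsTo`
applies. This is the argument of [Lange2023AbelianVarietiesComplex, Prop. 3.1.8–3.1.9] (the
orbit map `Sp_{2g}(ℝ) → 𝔥_g` is proper, so a discrete subgroup acts properly discontinuously)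
for the period domain `X⁺` of [Deligne1982HodgeCycles, p. 49], whose quotient `Γ\X⁺` is the
base of the family (p. 50). [cite: Lange2023AbelianVarietiesComplex, Ch. 3 §3.1 Prop. 3.1.9] -/
theorem finite_setOf_isometry_mapsTo_of_isCompact [FiniteDimensional ℝ V]
    {ψ : LinearMap.BilinForm ℝ V} {K : Set (V →L[ℝ] V)} (hK : IsCompact K)
    (hpos : ∀ J ∈ K, ∀ x, x ≠ 0 → 0 < ψ x (J x))
    (Λ : Submodule ℤ V) [DiscreteTopology Λ] [IsZLattice ℝ Λ] :
    {g : V →L[ℝ] V | (∀ x y, ψ (g x) (g y) = ψ x y) ∧ (∀ v ∈ Λ, g v ∈ Λ) ∧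
      ∃ J ∈ K, ∃ J' ∈ K, g * J = J' * g}.Finite := by
  obtain ⟨c, C, hc, hC, hb⟩ := exists_uniform_bounds_of_isCompact ψ hK hpos
  refine (finite_setOf_norm_le_mapsTo Λ (Real.sqrt (C / c))).subset ?_
  rintro g ⟨hgψ, hgΛ, J, hJ, J', hJ', hgJ⟩
  refine ⟨fun x => ?_, hgΛ⟩
  have hgJx : g (J x) = J' (g x) := by
    simpa only [mul_apply_eq_comp] using DFunLike.congr_fun hgJ x
  have h1 : c * ‖g x‖ ^ 2 ≤ C * ‖x‖ ^ 2 :=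
    calc c * ‖g x‖ ^ 2 ≤ ψ (g x) (J' (g x)) := (hb J' hJ' (g x)).1
      _ = ψ (g x) (g (J x)) := by rw [hgJx]
      _ = ψ x (J x) := hgψ x (J x)
      _ ≤ C * ‖x‖ ^ 2 := (hb J hJ x).2
  have h2 : ‖g x‖ ^ 2 ≤ C / c * ‖x‖ ^ 2 := by
    rw [div_mul_eq_mul_div, le_div_iff₀ hc]
    linarith
  calc ‖g x‖ = Real.sqrt (‖g x‖ ^ 2) := (Real.sqrt_sq (norm_nonneg _)).symm
    _ ≤ Real.sqrt (C / c * ‖x‖ ^ 2) := Real.sqrt_le_sqrt h2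
    _ = Real.sqrt (C / c) * ‖x‖ := by
        rw [Real.sqrt_mul (div_nonneg hC hc.le), Real.sqrt_sq (norm_nonneg _)]

/-! ### `X⁺` is locally closed in `End V`, hence locally compact -/

/-- **Positivity is an open condition**: the set of `ψ`-positive operators
(`ψ (x, J x) > 0` for `x ≠ 0`) is open in `End V` (finite dimension: positivity of the jointly
continuous `(J, x) ↦ ψ (x, J x)` propagates from the compact unit sphere to a neighbourhood, tube
lemma). In particular `X⁺` is open in the real algebraic set of `k`-linear `ψ`-isometric complex
structures ("an open connected complex submanifold", [Deligne1982HodgeCycles, p. 49]).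
[folklore] -/
theorem isOpen_setOf_pos [FiniteDimensional ℝ V] (ψ : LinearMap.BilinForm ℝ V) :
    IsOpen {J : V →L[ℝ] V | ∀ x, x ≠ 0 → 0 < ψ x (J x)} := by
  rw [isOpen_iff_mem_nhds]
  intro J₀ hJ₀
  have hFc : Continuous fun p : (V →L[ℝ] V) × V => ψ p.2 (p.1 p.2) :=
    continuous_apply_apply_self ψ
  have hev : ∀ᶠ J in 𝓝 J₀, ∀ y ∈ sphere (0 : V) 1, 0 < ψ y (J y) := by
    refine (isCompact_sphere (0 : V) 1).eventually_forall_of_forall_eventually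
      (P := fun (J : V →L[ℝ] V) (y : V) => 0 < ψ y (J y)) fun y hy => ?_
    exact (hFc.tendsto (J₀, y)).eventually (lt_mem_nhds (hJ₀ y (ne_zero_of_mem_unit_sphere hy)))
  filter_upwards [hev] with J hJ x hx
  have hnx : 0 < ‖x‖ := norm_pos_iff.2 hx
  have h := hJ _ (inv_norm_smul_mem_sphere hx)
  simp only [map_smul, LinearMap.smul_apply, smul_eq_mul] at h
  have hi : 0 < ‖x‖⁻¹ := inv_pos.2 hnx
  rwa [mul_pos_iff_of_pos_left hi, mul_pos_iff_of_pos_left hi] at h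

/-- The `k`-linear `ψ`-isometric complex structures form a closed (real algebraic) subset of
`End V`. [folklore] -/
theorem isClosed_setOf_sq_commute_isometry [FiniteDimensional ℝ V] (k : V →L[ℝ] V)
    (ψ : LinearMap.BilinForm ℝ V) :
    IsClosed {J : V →L[ℝ] V | J * J = -1 ∧ Commute J k ∧ ∀ x y, ψ (J x) (J y) = ψ x y} := by
  have hψc := continuous_bilin_uncurry ψ
  have h1 : IsClosed {J : V →L[ℝ] V | J * J = -1} :=
    isClosed_eq (continuous_id.mul continuous_id) continuous_const
  have h2 : IsClosed {J : V →L[ℝ] V | Commute J k} := by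
    simp only [commute_iff_eq]
    exact isClosed_eq (continuous_id.mul continuous_const) (continuous_const.mul continuous_id)
  have h3 : IsClosed {J : V →L[ℝ] V | ∀ x y, ψ (J x) (J y) = ψ x y} := by
    simp only [Set.setOf_forall]
    refine isClosed_iInter fun x => isClosed_iInter fun y => isClosed_eq ?_ continuous_const
    have h : Continuous fun J : V →L[ℝ] V => (J x, J y) := by fun_prop
    exact hψc.comp h
  simpa only [Set.setOf_and] using h1.inter (h2.inter h3)

/-- `X⁺` is the intersection of the closed set of `k`-linear `ψ`-isometric complex structures
with the open set of `ψ`-positive operators. [folklore] -/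
theorem posComplexStructures_eq_inter (k : V →L[ℝ] V) (ψ : LinearMap.BilinForm ℝ V) :
    posComplexStructures k ψ =
      {J : V →L[ℝ] V | J * J = -1 ∧ Commute J k ∧ ∀ x y, ψ (J x) (J y) = ψ x y} ∩
        {J | ∀ x, x ≠ 0 → 0 < ψ x (J x)} := by
  ext J
  simp only [posComplexStructures, Set.mem_setOf_eq, Set.mem_inter_iff, and_assoc]

/-- `X⁺` is locally closed in `End V`. [folklore] -/
theorem isLocallyClosed_posComplexStructures [FiniteDimensional ℝ V] (k : V →L[ℝ] V)
    (ψ : LinearMap.BilinForm ℝ V) : IsLocallyClosed (posComplexStructures k ψ) := by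
  rw [posComplexStructures_eq_inter]
  exact (isClosed_setOf_sq_commute_isometry k ψ).isLocallyClosed.inter
    (isOpen_setOf_pos ψ).isLocallyClosed

/-- `X⁺` is locally compact (a locally closed subset of the finite-dimensional `End V`).
[folklore] -/
instance locallyCompactSpace_posComplexStructures [FiniteDimensional ℝ V] (k : V →L[ℝ] V)
    (ψ : LinearMap.BilinForm ℝ V) : LocallyCompactSpace (posComplexStructures k ψ) :=
  (isLocallyClosed_posComplexStructures k ψ).locallyCompactSpace

/-! ### The arithmetic group `Aut(Λ, ψ, k)` and its conjugation action on `X⁺` -/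

/-- `g (g⁻¹ x) = x` for a unit `g` of `End V`. [folklore] -/
theorem units_apply_inv_apply (g : (V →L[ℝ] V)ˣ) (x : V) :
    (g : V →L[ℝ] V) (((g⁻¹ : (V →L[ℝ] V)ˣ) : V →L[ℝ] V) x) = x := by
  rw [← mul_apply_eq_comp, Units.mul_inv, one_apply_eq_self]

/-- `g⁻¹ (g x) = x` for a unit `g` of `End V`. [folklore] -/
theorem units_inv_apply_apply (g : (V →L[ℝ] V)ˣ) (x : V) :
    ((g⁻¹ : (V →L[ℝ] V)ˣ) : V →L[ℝ] V) ((g : V →L[ℝ] V) x) = x := by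
  rw [← mul_apply_eq_comp, Units.inv_mul, one_apply_eq_self]

/-- The inverse of a `ψ`-isometric unit is `ψ`-isometric. [folklore] -/
theorem units_inv_isometry {ψ : LinearMap.BilinForm ℝ V} {g : (V →L[ℝ] V)ˣ}
    (hgψ : ∀ x y, ψ ((g : V →L[ℝ] V) x) ((g : V →L[ℝ] V) y) = ψ x y) (x y : V) :
    ψ (((g⁻¹ : (V →L[ℝ] V)ˣ) : V →L[ℝ] V) x) (((g⁻¹ : (V →L[ℝ] V)ˣ) : V →L[ℝ] V) y) = ψ x y := by
  rw [← hgψ, units_apply_inv_apply, units_apply_inv_apply]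

/-- **Deligne's arithmetic group** `Γ = Aut(V(ℤ), ψ) ∩ {g | g k = k g}` (level `1`): the units
`g` of `End V` preserving the alternating form `ψ`, commuting with the action `k` of `√-d`
(`𝒪_E`-linearity) and preserving the lattice `Λ = V(ℤ)` (`g Λ = Λ`), as a subgroup of `GL(V)`.
Its congruence subgroups `{g | (g - 1) V(ℤ) ⊂ n V(ℤ)}` are the groups `Γ` of
[Deligne1982HodgeCycles, proof of Thm. 4.8, p. 48 and p. 50].
[cite: Deligne1982HodgeCycles, proof of Thm. 4.8, pp. 48–50] -/
def arithmeticGroup (k : V →L[ℝ] V) (ψ : LinearMap.BilinForm ℝ V) (Λ : Submodule ℤ V) :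
    Subgroup (V →L[ℝ] V)ˣ where
  carrier := {g | (∀ x y, ψ ((g : V →L[ℝ] V) x) ((g : V →L[ℝ] V) y) = ψ x y) ∧
    Commute (g : V →L[ℝ] V) k ∧ (∀ v ∈ Λ, (g : V →L[ℝ] V) v ∈ Λ) ∧
    ∀ v ∈ Λ, ((g⁻¹ : (V →L[ℝ] V)ˣ) : V →L[ℝ] V) v ∈ Λ}
  one_mem' := ⟨fun x y => rfl, Commute.one_left k, fun v hv => hv, fun v hv => by simpa using hv⟩
  mul_mem' := by
    rintro g h ⟨hgψ, hgk, hgΛ, hgΛ'⟩ ⟨hhψ, hhk, hhΛ, hhΛ'⟩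
    refine ⟨fun x y => ?_, hgk.mul_left hhk, fun v hv => ?_, fun v hv => ?_⟩
    · rw [Units.val_mul, mul_apply_eq_comp, mul_apply_eq_comp, hgψ, hhψ]
    · rw [Units.val_mul, mul_apply_eq_comp]
      exact hgΛ _ (hhΛ _ hv)
    · rw [mul_inv_rev, Units.val_mul, mul_apply_eq_comp]
      exact hhΛ' _ (hgΛ' _ hv)
  inv_mem' := by
    rintro g ⟨hgψ, hgk, hgΛ, hgΛ'⟩
    exact ⟨units_inv_isometry hgψ, hgk.units_inv_left, hgΛ', fun v hv => by
      simpa only [inv_inv] using hgΛ v hv⟩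

namespace arithmeticGroup

variable {k : V →L[ℝ] V} {ψ : LinearMap.BilinForm ℝ V} {Λ : Submodule ℤ V}

/-- Membership in the arithmetic group, unfolded. [folklore] -/
theorem mem_iff {g : (V →L[ℝ] V)ˣ} :
    g ∈ arithmeticGroup k ψ Λ ↔ (∀ x y, ψ ((g : V →L[ℝ] V) x) ((g : V →L[ℝ] V) y) = ψ x y) ∧
      Commute (g : V →L[ℝ] V) k ∧ (∀ v ∈ Λ, (g : V →L[ℝ] V) v ∈ Λ) ∧
      ∀ v ∈ Λ, ((g⁻¹ : (V →L[ℝ] V)ˣ) : V →L[ℝ] V) v ∈ Λ :=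
  Iff.rfl

/-- **Conjugation preserves `X⁺`.** A `ψ`-isometric unit `g` commuting with `k` carries a
`k`-linear `ψ`-positive complex structure `J` to `g J g⁻¹ ∈ X⁺` (transport of structure,
[Deligne1982HodgeCycles, p. 50]: "`Γ` acts on `X⁺`"). [folklore] -/
theorem conj_units_mem_posComplexStructures {g : (V →L[ℝ] V)ˣ}
    (hgψ : ∀ x y, ψ ((g : V →L[ℝ] V) x) ((g : V →L[ℝ] V) y) = ψ x y)
    (hgk : Commute (g : V →L[ℝ] V) k) {J : V →L[ℝ] V} (hJ : J ∈ posComplexStructures k ψ) :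
    (g : V →L[ℝ] V) * J * ((g⁻¹ : (V →L[ℝ] V)ˣ) : V →L[ℝ] V) ∈ posComplexStructures k ψ := by
  obtain ⟨hJJ, hJk, hJψ, hJpos⟩ := hJ
  have hJJ' : ∀ x, J (J x) = -x := fun x => by
    simpa only [mul_apply_eq_comp, neg_apply,
      one_apply_eq_self] using DFunLike.congr_fun hJJ x
  refine ⟨?_, (hgk.mul_left hJk).mul_left hgk.units_inv_left, fun x y => ?_, fun x hx => ?_⟩
  · ext x
    simp only [mul_apply_eq_comp, neg_apply,
      one_apply_eq_self, units_inv_apply_apply, hJJ', map_neg, units_apply_inv_apply]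
  · simp only [mul_apply_eq_comp]
    rw [hgψ, hJψ, units_inv_isometry hgψ]
  · have hx' : ((g⁻¹ : (V →L[ℝ] V)ˣ) : V →L[ℝ] V) x ≠ 0 := fun h => hx (by
      rw [← units_apply_inv_apply g x, h, map_zero])
    have h := hJpos _ hx'
    rw [← hgψ, units_apply_inv_apply] at h
    simpa only [mul_apply_eq_comp] using h

/-- The conjugation action `J ↦ g J g⁻¹` of the arithmetic group on `X⁺`
([Deligne1982HodgeCycles, p. 50]). [cite: Deligne1982HodgeCycles, proof of Thm. 4.8, p. 50] -/
instance mulAction : MulAction (arithmeticGroup k ψ Λ) (posComplexStructures k ψ) where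
  smul g J := ⟨((g : (V →L[ℝ] V)ˣ) : V →L[ℝ] V) * J * (((g : (V →L[ℝ] V)ˣ)⁻¹ : (V →L[ℝ] V)ˣ) :
      V →L[ℝ] V), conj_units_mem_posComplexStructures g.2.1 g.2.2.1 J.2⟩
  one_smul J := by
    ext1
    change ((1 : (V →L[ℝ] V)ˣ) : V →L[ℝ] V) * J * (((1 : (V →L[ℝ] V)ˣ)⁻¹ : (V →L[ℝ] V)ˣ) :
      V →L[ℝ] V) = J
    rw [inv_one, Units.val_one, one_mul, mul_one]
  mul_smul g h J := by
    ext1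
    change ((g * h : arithmeticGroup k ψ Λ) : (V →L[ℝ] V)ˣ) * (J : V →L[ℝ] V) *
        ((((g * h : arithmeticGroup k ψ Λ) : (V →L[ℝ] V)ˣ)⁻¹ : (V →L[ℝ] V)ˣ) : V →L[ℝ] V) =
      ((g : (V →L[ℝ] V)ˣ) : V →L[ℝ] V) * (((h : (V →L[ℝ] V)ˣ) : V →L[ℝ] V) * J *
        (((h : (V →L[ℝ] V)ˣ)⁻¹ : (V →L[ℝ] V)ˣ) : V →L[ℝ] V)) *
        (((g : (V →L[ℝ] V)ˣ)⁻¹ : (V →L[ℝ] V)ˣ) : V →L[ℝ] V)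
    rw [Subgroup.coe_mul, mul_inv_rev, Units.val_mul, Units.val_mul]
    simp only [mul_assoc]

/-- `g • J = g J g⁻¹`. [folklore] -/
@[simp] theorem coe_smul (g : arithmeticGroup k ψ Λ) (J : posComplexStructures k ψ) :
    ((g • J : posComplexStructures k ψ) : V →L[ℝ] V) =
      ((g : (V →L[ℝ] V)ˣ) : V →L[ℝ] V) * J * (((g : (V →L[ℝ] V)ˣ)⁻¹ : (V →L[ℝ] V)ˣ) :
        V →L[ℝ] V) :=
  rfl

/-- The conjugation action is by homeomorphisms. [folklore] -/
instance continuousConstSMul :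
    ContinuousConstSMul (arithmeticGroup k ψ Λ) (posComplexStructures k ψ) :=
  ⟨fun _ => ((continuous_const.mul continuous_subtype_val).mul continuous_const).subtype_mk _⟩

/-- **The arithmetic group acts properly discontinuously on `X⁺`** ([Deligne1982HodgeCycles,
p. 50]; the unitary analogue of [Lange2023AbelianVarietiesComplex, Prop. 3.1.9]): for compact
`K, L ⊆ X⁺` only finitely many `γ ∈ Aut(Λ, ψ, k)` have `γ K γ⁻¹ ∩ L ≠ ∅` — by
`finite_setOf_isometry_mapsTo_of_isCompact` applied to the compact set `K ∪ L` of positive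
complex structures, since `γ ↦ γ ∈ End V` is injective.
[cite: Lange2023AbelianVarietiesComplex, Ch. 3 §3.1 Prop. 3.1.9] -/
instance properlyDiscontinuousSMul [FiniteDimensional ℝ V] [DiscreteTopology Λ]
    [IsZLattice ℝ Λ] :
    ProperlyDiscontinuousSMul (arithmeticGroup k ψ Λ) (posComplexStructures k ψ) where
  finite_disjoint_inter_image := by
    intro K L hK hL
    set K' : Set (V →L[ℝ] V) := Subtype.val '' K ∪ Subtype.val '' L with hK'
    have hK'c : IsCompact K' :=
      (hK.image continuous_subtype_val).union (hL.image continuous_subtype_val)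
    have hpos : ∀ J ∈ K', ∀ x, x ≠ 0 → 0 < ψ x (J x) := by
      rintro J hJ
      have hJX : J ∈ posComplexStructures k ψ := by
        rcases hJ with ⟨J₁, -, rfl⟩ | ⟨J₁, -, rfl⟩ <;> exact J₁.2
      exact hJX.2.2.2
    have hfin := finite_setOf_isometry_mapsTo_of_isCompact hK'c hpos Λ
    have hinj : Function.Injective
        fun γ : arithmeticGroup k ψ Λ => ((γ : (V →L[ℝ] V)ˣ) : V →L[ℝ] V) :=
      Units.val_injective.comp Subtype.val_injective
    refine (hfin.preimage hinj.injOn).subset fun γ hγ => ?_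
    have hγ' : ((fun x => γ • x) '' K ∩ L).Nonempty := hγ
    obtain ⟨_, ⟨J, hJK, rfl⟩, hJL⟩ := hγ'
    refine ⟨γ.2.1, γ.2.2.2.1, (J : V →L[ℝ] V), Or.inl ⟨J, hJK, rfl⟩,
      ((γ • J : posComplexStructures k ψ) : V →L[ℝ] V), Or.inr ⟨γ • J, hJL, rfl⟩, ?_⟩
    rw [coe_smul, mul_assoc _ _ ((γ : (V →L[ℝ] V)ˣ) : V →L[ℝ] V), Units.inv_mul, mul_one]

/-- Every subgroup of the arithmetic group acts by homeomorphisms. [folklore] -/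
instance continuousConstSMul_subgroup (G : Subgroup (arithmeticGroup k ψ Λ)) :
    ContinuousConstSMul G (posComplexStructures k ψ) :=
  ⟨fun g => continuous_const_smul (g : arithmeticGroup k ψ Λ)⟩

/-- Every subgroup `G` of the arithmetic group (e.g. a congruence subgroup `Γ(n)`) acts properly
discontinuously on `X⁺` (Mathlib: subgroups inherit proper discontinuity). [folklore] -/
theorem properlyDiscontinuousSMul_subgroup [FiniteDimensional ℝ V] [DiscreteTopology Λ]
    [IsZLattice ℝ Λ] (G : Subgroup (arithmeticGroup k ψ Λ)) :
    ProperlyDiscontinuousSMul G (posComplexStructures k ψ) :=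
  inferInstance

/-- **`Γ\X⁺` is Hausdorff** for every subgroup `Γ` of the arithmetic group: the quotient of the
locally compact Hausdorff space `X⁺` by a properly discontinuous action by homeomorphisms
(Mathlib `t2Space_of_properlyDiscontinuousSMul_of_t2Space`). [folklore] -/
theorem t2Space_quotient [FiniteDimensional ℝ V] [DiscreteTopology Λ] [IsZLattice ℝ Λ]
    (G : Subgroup (arithmeticGroup k ψ Λ)) :
    T2Space (Quotient (MulAction.orbitRel G (posComplexStructures k ψ))) :=
  inferInstance

/-- **A subgroup without non-trivial elements of finite order acts freely on `X⁺`** (e.g. the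
congruence subgroup `Γ(n)`, `n ≥ 3`, [Deligne1982HodgeCycles, p. 50], by Minkowski–Serre): if
`g • J = J` then `g` commutes with `J`, so all powers of `g` lie in the finite stabiliser of `J`
(`eq_one_of_commute_of_torsionFree`), and `g = 1`. [folklore] -/
theorem isCancelSMul_of_torsionFree [FiniteDimensional ℝ V] [DiscreteTopology Λ]
    [IsZLattice ℝ Λ] (G : Subgroup (arithmeticGroup k ψ Λ))
    (htf : ∀ g : G, IsOfFinOrder g → g = 1) : IsCancelSMul G (posComplexStructures k ψ) := by
  rw [isCancelSMul_iff_eq_one_of_smul_eq]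
  intro g J hgJ
  -- the image `G₀ ⊂ GL(V)` of `G`
  set G₀ : Subgroup (V →L[ℝ] V)ˣ := (G.map (arithmeticGroup k ψ Λ).subtype) with hG₀
  have hmem : ∀ u ∈ G₀, ∃ γ : G, ((γ : arithmeticGroup k ψ Λ) : (V →L[ℝ] V)ˣ) = u := by
    intro u hu
    obtain ⟨γ, hγ, rfl⟩ := Subgroup.mem_map.1 hu
    exact ⟨⟨γ, hγ⟩, rfl⟩
  have hGψ : ∀ u ∈ G₀, ∀ x y, ψ ((u : V →L[ℝ] V) x) ((u : V →L[ℝ] V) y) = ψ x y := by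
    intro u hu
    obtain ⟨γ, rfl⟩ := hmem u hu
    exact (γ : arithmeticGroup k ψ Λ).2.1
  have hGΛ : ∀ u ∈ G₀, ∀ v ∈ Λ, (u : V →L[ℝ] V) v ∈ Λ := by
    intro u hu
    obtain ⟨γ, rfl⟩ := hmem u hu
    exact (γ : arithmeticGroup k ψ Λ).2.2.2.1
  have hinj : Function.Injective
      fun γ : G => ((γ : arithmeticGroup k ψ Λ) : (V →L[ℝ] V)ˣ) :=
    Subtype.val_injective.comp Subtype.val_injective
  have htf₀ : ∀ u ∈ G₀, IsOfFinOrder u → u = 1 := by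
    intro u hu hfin
    obtain ⟨γ, rfl⟩ := hmem u hu
    have hγfin : IsOfFinOrder γ := by
      rw [isOfFinOrder_iff_pow_eq_one] at hfin ⊢
      obtain ⟨n, hn, hγn⟩ := hfin
      refine ⟨n, hn, hinj ?_⟩
      simpa only [Subgroup.coe_pow, Subgroup.coe_one] using hγn
    rw [htf γ hγfin, Subgroup.coe_one, Subgroup.coe_one]
  have hg₀ : ((g : arithmeticGroup k ψ Λ) : (V →L[ℝ] V)ˣ) ∈ G₀ :=
    Subgroup.mem_map.2 ⟨g, g.2, rfl⟩
  -- `g J g⁻¹ = J` means that `g` commutes with `J`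
  have hcomm : Commute (((g : arithmeticGroup k ψ Λ) : (V →L[ℝ] V)ˣ) : V →L[ℝ] V) J := by
    have h := congr_arg Subtype.val hgJ
    rw [Submonoid.smul_def, coe_smul] at h
    have h' := congr_arg (· * (((g : arithmeticGroup k ψ Λ) : (V →L[ℝ] V)ˣ) : V →L[ℝ] V)) h
    simp only [mul_assoc, Units.inv_mul, mul_one] at h'
    exact h'
  have h1 := eq_one_of_commute_of_torsionFree J.2 Λ hGψ hGΛ htf₀ hg₀ hcomm
  exact hinj (by simpa only [Subgroup.coe_one] using h1)

/-- **`X⁺ → Γ\X⁺` is a covering map for torsion-free `Γ`.** For a subgroup `G` of the arithmetic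
group without non-trivial elements of finite order, the projection of `X⁺` onto the (Hausdorff)
orbit space `G\X⁺` is a quotient covering map with deck group `G` (Mathlib
`isQuotientCoveringMap_quotientMk_of_properlyDiscontinuousSMul`: a free, properly discontinuous
action by homeomorphisms of a locally compact Hausdorff space). This is the topological content
of "`Γ\X⁺` is a smooth variety and `Γ\B → Γ\X⁺` a family over it" in
[Deligne1982HodgeCycles, p. 50] (cf. [Lange2023AbelianVarietiesComplex, Remark 3.1.10 (2)]).
[folklore] -/
theorem isQuotientCoveringMap_of_torsionFree [FiniteDimensional ℝ V] [DiscreteTopology Λ]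
    [IsZLattice ℝ Λ] (G : Subgroup (arithmeticGroup k ψ Λ))
    (htf : ∀ g : G, IsOfFinOrder g → g = 1) :
    IsQuotientCoveringMap
      (Quotient.mk (MulAction.orbitRel G (posComplexStructures k ψ))) G := by
  haveI := isCancelSMul_of_torsionFree G htf
  exact isQuotientCoveringMap_quotientMk_of_properlyDiscontinuousSMul

/-- In particular `X⁺ → Γ\X⁺` is a covering map in the sense of `IsCoveringMap` for
torsion-free `Γ`. [folklore] -/
theorem isCoveringMap_quotientMk_of_torsionFree [FiniteDimensional ℝ V] [DiscreteTopology Λ]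
    [IsZLattice ℝ Λ] (G : Subgroup (arithmeticGroup k ψ Λ))
    (htf : ∀ g : G, IsOfFinOrder g → g = 1) :
    IsCoveringMap (Quotient.mk (MulAction.orbitRel G (posComplexStructures k ψ))) :=
  (isQuotientCoveringMap_of_torsionFree G htf).isCoveringMap

end arithmeticGroup

end Literature.LinearAlgebra.QuadraticForm
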